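import Summits.QuantumFields.YangMills.Theorems.BalabanUVNodesN15KingModelBoxEvenSymbol
import Summits.QuantumFields.YangMills.Theorems.BalabanUVNodesN15KingModelFreeEnergyMassDerivative
import Summits.QuantumFields.YangMills.Theorems.BalabanUVNodesN15KingModelBoxBulkLimit
import HarnessLib

/-!
# BalabanUVNodes ∕ N15 — THE KING-MODEL RUNG (PART Ϟ-m): FLUCTUATION–RESPONSE ON KING's REGION `Ω` AND THE SPATIALLY AVERAGED NEUMANN GREEN's FUNCTION DIAGONAL —
# `∂_{m²}ln det(c(−Δ_free)+m²)_Ω = tr G^Ω = Σ_{k∈Ω} lapSym(2n)(k̂)⁻¹ = Σ_{s∈Ω} G^Ω(s,s)`, `|G_{T(2n)}(x,x) − |Ω|⁻¹Σ_s G^Ω(s,s)| ≤ (2∕m²)·Σ_μ1∕n_μ`, and `|Ω_j|⁻¹Σ_s G^{Ω_j}(s,s) → K_∞(0) = ∂_{m²}f_∞`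
# (Track A, DAG node N15 = NE2; FAN-OUT v1.1 §N15 s3 «KING-MODEL RUNG»; King p.670 l.8–13 «free boundary conditions»; count-neutral)

HONEST FRAMING.  Count-neutral (cell `pub-ymgap`, seat `pub-ymgap-dag-n15-e` g41; `--supports stmt-QuantumFields-27366 --as helper` = K3⁸).
TEMPLATE LITERATURE: C. King, Commun. Math. Phys. **102** (1986) 649–677 [King1986]: (2.13)∕(2.17) p.653 (`B = c(−Δ)+m²`, `B⁻¹`), (3.89) p.668, (4.4) p.670, §4 p.670 l.8–13.  Parts Ε-x∕Ε-y
(g40) proved the fluctuation–response identity on the TORUS (`∂_{m²}|T|⁻¹ln det = G(x,x)`, `∂_{m²}f_∞ = K_∞(0)`); part Ϟ-c gave `det boxOp = Π_k lapSym(2n)(k̂)` and the Neumann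
Green's function `G^Ω = (boxOp)⁻¹` in the cosine basis; parts Ϟ-e∕Ϟ-i the tiling of the doubled torus's dual by shifted half grids and the generic telescoping bound.  With FREE
boundary conditions the coincident-point covariance `G^Ω(s,s)` is NOT constant in `s` (image charges near the walls); THIS FILE proves the identities for its TRACE ∕ SPATIAL
AVERAGE: §1 ★★★ **`hasDerivAt_log_det_boxOp`** (`∂_{m²}ln det(c(−Δ_free)+m²)_Ω = Σ_k lapSym(2n)(k̂)⁻¹`), ★★ **`trace_boxOp_inv_eq_sum`** (`tr G^Ω = Σ_k lapSym(k̂)⁻¹`), ★★★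
**`hasDerivAt_log_det_boxOp_eq_trace`** (JACOBI on Ω), ★ `trace_boxOp_inv_eq_sum_kingBoxGreen_diag`, ★★ `avg_kingBoxGreen_diag_bounds` (`(m²+4c(d+1))⁻¹ ≤ |Ω|⁻¹Σ_sG^Ω(s,s) ≤ m⁻²`);
§2 `inv_lapSym_torReflS_dblBox`, ★★ `sum_inv_lapSym_dblTorus_eq` (tiling for `h = 1∕sym`), ★★★ **`abs_lapF_dbl_inv_diag_sub_avg_kingBoxGreen_diag_le`** (`|G_{T(2n)}(x,x) − |Ω|⁻¹Σ_sG^Ω(s,s)|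
≤ (2∕m²)Σ_μ1∕n_μ` — the torus coincident-point covariance vs the box average, surface∕volume rate); §3 `tendsto_boxMin_atTop`, ★★★ **`tendsto_avg_kingBoxGreen_diag`**
(`|Ω_j|⁻¹Σ_sG^{Ω_j}(s,s) → K_∞(0)` along ANY boxes with all sides `→ ∞`), ★★ **`tendsto_deriv_log_det_boxOp_div_card`** (`∂_{m²}(|Ω_j|⁻¹ln det(c(−Δ_free)+m²)_{Ω_j}) → ∂_{m²}f_∞ = K_∞(0)`:
fluctuation–response commutes with the free-boundary thermodynamic limit).

PRIOR TREE ART (named, USED not restated): Ϟ-a∕Ϟ-c (`boxWave`, `trace_eq_sum_of_boxWave_eigen`, `boxOp_inv_mulVec_boxWave`, `log_det_boxOp`, `lapSym_dblBox`,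
`boxOp_inv_eq_kingBoxGreen`), Ϟ-e (`cos_sOf_torReflS_dblBox`, `card_kingBox`), Ϟ-g∕Ϟ-i (`boxShiftPt`, `boxShiftSum`, `abs_boxShiftSum_sub_empty_le`), Ν-b (`sum_dblTorus_eq_sum_images`,
`card_dblTorus_eq`), Ε-e (`lapF_inv_diag_eq`, `lapSym_le`), Ε-f (`abs_lapF_inv_sub_freeKer_le`, `centredDiff`), Ε-x (`hasDerivAt_log_lapSym` pattern), Ε-y
(`hasDerivAt_kingFreeEnergyInf_eq_freeKer_zero`), `King1986` (`lapSym`, `lapSym_ge`), pv17 `B4TorusKernel` (`periodConst`, `translate`).  NOT Bałaban's covariant objects; NOT a node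
discharge (N15 is booked through n15-a's knit, untouched); nothing continuum-YM ∕ `ℝ⁴` ∕ OS ∕ Clay.  0 `sorry`; 0 `def`.

HONEST SCOPE.  King's `A = 0` free operator (`c ≥ 0`, `m² > 0`) on boxes `Ω`; statements about the TRACE ∕ spatial average of the Neumann Green's function diagonal (the individual
`G^Ω(s,s)` depend on the distance to the walls and are not computed).  Locators: [King1986] (2.13)∕(2.17) p.653, (3.89) p.668, (4.4) p.670, §4 p.670 l.8–13.
-/

noncomputable section

open scoped BigOperators Topology
open Finset Filter Matrix

namespace Summit.QuantumFields.YangMills.BalabanUVNodes.N15KingModelRung.TorusSpectral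

open Literature.MathematicalPhysics.QuantumFieldTheory.Balaban1983to89.B5Prop11Plancherel (Tor sOf)
open Literature.MathematicalPhysics.QuantumFieldTheory.Balaban1983to89.B4TorusKernel (periodConst)
open Literature.MathematicalPhysics.QuantumFieldTheory.King1986.Torus

variable {d : ℕ}

/-! ## §1 Fluctuation–response on `Ω`: the mass derivative of the free energy is the trace of the Neumann Green's function -/

section Derivative

variable (n : Fin (d + 1) → ℕ) [hn : ∀ μ, NeZero (n μ)] {c : ℝ}

omit hn in
/-- `∂_{m²} Σ_k ln lapSym(2n)(k̂) = Σ_k lapSym(2n)(k̂)⁻¹`. [cite: King1986, (4.4) p.670] -/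
theorem hasDerivAt_sum_log_lapSym_dblBox (hc : 0 ≤ c) {m2 : ℝ} (hm : 0 < m2) :
    HasDerivAt (fun m => ∑ k : KingBox n, Real.log (lapSym (dblPer n) c m (dblBox n k))) (∑ k : KingBox n, (lapSym (dblPer n) c m2 (dblBox n k))⁻¹) m2 := by
  refine HasDerivAt.fun_sum fun k _ => ?_
  have hpos : 0 < lapSym (dblPer n) c m2 (dblBox n k) := lt_of_lt_of_le hm (lapSym_ge (dblPer n) c m2 hc _)
  have h1 : HasDerivAt (fun m => lapSym (dblPer n) c m (dblBox n k)) 1 m2 := by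
    unfold lapSym
    exact (hasDerivAt_id m2).add_const _
  simpa using h1.log hpos.ne'

/-- ★★★ **`∂_{m²} ln det(c(−Δ_free)+m²)_Ω = Σ_{k∈Ω} lapSym(2n)(k̂)⁻¹`** (Ϟ-c's closed form differentiated; `c ≥ 0`, `m² > 0`, every box). [cite: King1986, (3.89) p.668, (4.4) p.670, §4 p.670] -/
theorem hasDerivAt_log_det_boxOp (hc : 0 ≤ c) {m2 : ℝ} (hm : 0 < m2) :
    HasDerivAt (fun m => Real.log (boxOp n c m).det) (∑ k : KingBox n, (lapSym (dblPer n) c m2 (dblBox n k))⁻¹) m2 := by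
  refine (hasDerivAt_sum_log_lapSym_dblBox n hc hm).congr_of_eventuallyEq ?_
  filter_upwards [Ioi_mem_nhds hm] with m hm'
  exact log_det_boxOp n hc hm'

/-- ★★ **`tr G^Ω = Σ_{k∈Ω} lapSym(2n)(k̂)⁻¹`** (the Neumann Green's function has the cosine waves as eigenvectors with eigenvalues `lapSym(k̂)⁻¹`). [cite: King1986, (2.17) p.653, §4 p.670] -/
theorem trace_boxOp_inv_eq_sum (hc : 0 ≤ c) {m2 : ℝ} (hm : 0 < m2) :
    ((boxOp n c m2)⁻¹).trace = ∑ k : KingBox n, (lapSym (dblPer n) c m2 (dblBox n k))⁻¹ :=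
  trace_eq_sum_of_boxWave_eigen n _ _ (boxOp_inv_mulVec_boxWave n hc hm)

/-- ★★★ **JACOBI's FORMULA ON `Ω`: `∂_{m²} ln det(c(−Δ_free)+m²)_Ω = tr G^Ω`.** [cite: King1986, (3.89) p.668, (2.17) p.653, §4 p.670] -/
theorem hasDerivAt_log_det_boxOp_eq_trace (hc : 0 ≤ c) {m2 : ℝ} (hm : 0 < m2) :
    HasDerivAt (fun m => Real.log (boxOp n c m).det) (((boxOp n c m2)⁻¹).trace) m2 := by
  rw [trace_boxOp_inv_eq_sum n hc hm]
  exact hasDerivAt_log_det_boxOp n hc hm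

/-- ★ `tr G^Ω = Σ_{s∈Ω} G^Ω(s,s)` with `G^Ω = kingBoxGreen` (the image sum). [cite: King1986, (2.17) p.653, §4 p.670] -/
theorem trace_boxOp_inv_eq_sum_kingBoxGreen_diag (hc : 0 ≤ c) {m2 : ℝ} (hm : 0 < m2) :
    ((boxOp n c m2)⁻¹).trace = ∑ s : KingBox n, kingBoxGreen n c m2 s s := by
  rw [Matrix.trace]
  exact Finset.sum_congr rfl fun s _ => by rw [Matrix.diag_apply, boxOp_inv_eq_kingBoxGreen n hc hm]

/-- ★★ **THE AVERAGED COINCIDENT-POINT COVARIANCE ON `Ω` IS BOUNDED LIKE THE TORUS ONE**: `(m²+4c(d+1))⁻¹ ≤ |Ω|⁻¹Σ_sG^Ω(s,s) ≤ m⁻²`. [cite: King1986, (4.4) p.670, §4 p.670] -/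
theorem avg_kingBoxGreen_diag_bounds (hc : 0 ≤ c) {m2 : ℝ} (hm : 0 < m2) :
    (m2 + 4 * c * (d + 1))⁻¹ ≤ (Fintype.card (KingBox n) : ℝ)⁻¹ * ∑ s : KingBox n, kingBoxGreen n c m2 s s ∧
      (Fintype.card (KingBox n) : ℝ)⁻¹ * ∑ s : KingBox n, kingBoxGreen n c m2 s s ≤ m2⁻¹ := by
  rw [← trace_boxOp_inv_eq_sum_kingBoxGreen_diag n hc hm, trace_boxOp_inv_eq_sum n hc hm]
  have hcard : (0 : ℝ) < Fintype.card (KingBox n) := by exact_mod_cast Fintype.card_pos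
  have hlo : ∀ k : KingBox n, (m2 + 4 * c * (d + 1))⁻¹ ≤ (lapSym (dblPer n) c m2 (dblBox n k))⁻¹ := fun k =>
    inv_anti₀ (lt_of_lt_of_le hm (lapSym_ge (dblPer n) c m2 hc _)) (lapSym_le (dblPer n) hc m2 _)
  have hhi : ∀ k : KingBox n, (lapSym (dblPer n) c m2 (dblBox n k))⁻¹ ≤ m2⁻¹ := fun k => inv_anti₀ hm (lapSym_ge (dblPer n) c m2 hc _)
  constructor
  · rw [le_inv_mul_iff₀ hcard]
    calc (Fintype.card (KingBox n) : ℝ) * (m2 + 4 * c * (d + 1))⁻¹ = ∑ _k : KingBox n, (m2 + 4 * c * (d + 1))⁻¹ := by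
          rw [Finset.sum_const, Finset.card_univ, nsmul_eq_mul]
      _ ≤ _ := Finset.sum_le_sum fun k _ => hlo k
  · rw [inv_mul_le_iff₀ hcard]
    calc ∑ k : KingBox n, (lapSym (dblPer n) c m2 (dblBox n k))⁻¹ ≤ ∑ _k : KingBox n, m2⁻¹ := Finset.sum_le_sum fun k _ => hhi k
      _ = _ := by rw [Finset.sum_const, Finset.card_univ, nsmul_eq_mul]

/-- ★★ **PER SITE**: `∂_{m²}(|Ω|⁻¹ln det(c(−Δ_free)+m²)_Ω) = |Ω|⁻¹Σ_sG^Ω(s,s)` — the mass derivative of the free energy density is the AVERAGED coincident-point covariance.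
[cite: King1986, (3.89) p.668, (2.17) p.653, §4 p.670] -/
theorem hasDerivAt_log_det_boxOp_div_card (hc : 0 ≤ c) {m2 : ℝ} (hm : 0 < m2) :
    HasDerivAt (fun m => (Fintype.card (KingBox n) : ℝ)⁻¹ * Real.log (boxOp n c m).det)
      ((Fintype.card (KingBox n) : ℝ)⁻¹ * ∑ s : KingBox n, kingBoxGreen n c m2 s s) m2 := by
  rw [← trace_boxOp_inv_eq_sum_kingBoxGreen_diag n hc hm]
  exact (hasDerivAt_log_det_boxOp_eq_trace n hc hm).const_mul _

end Derivative

/-! ## §2 The torus coincident-point covariance versus the box average, at finite volume -/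

section Comparison

variable (n : Fin (d + 1) → ℕ) [hn : ∀ μ, NeZero (n μ)] {c m2 : ℝ}

/-- `lapSym(2n)(σ_S k̂)⁻¹ = h(boxShiftPt S k)` with `h(p) = (m² + cΣ_μ(2−2cos p_μ))⁻¹`. [cite: King1986, (4.4) p.670] -/
theorem inv_lapSym_torReflS_dblBox (c m2 : ℝ) (S : Finset (Fin (d + 1))) (k : KingBox n) :
    (lapSym (dblPer n) c m2 (torReflS (dblPer n) S (dblBox n k)))⁻¹ = (fun p : Fin (d + 1) → ℝ => (m2 + c * ∑ μ, (2 - 2 * Real.cos (p μ)))⁻¹) (boxShiftPt n S k) := by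
  unfold lapSym
  simp only [boxShiftPt]
  simp_rw [cos_sOf_torReflS_dblBox]

/-- ★★ tiling for the inverse symbol: `Σ_{q∈T̂(2n)} lapSym(q)⁻¹ = Σ_S boxShiftSum (1∕sym) S`. [cite: King1986, (4.4) p.670, §4 p.670] -/
theorem sum_inv_lapSym_dblTorus_eq (c m2 : ℝ) :
    ∑ q : Tor (dblPer n), (lapSym (dblPer n) c m2 q)⁻¹
      = ∑ S : Finset (Fin (d + 1)), boxShiftSum n (fun p : Fin (d + 1) → ℝ => (m2 + c * ∑ μ, (2 - 2 * Real.cos (p μ)))⁻¹) S := by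
  rw [sum_dblTorus_eq_sum_images n (fun q => (lapSym (dblPer n) c m2 q)⁻¹)]
  refine Finset.sum_congr rfl fun S _ => ?_
  unfold boxShiftSum
  exact Finset.sum_congr rfl fun k _ => inv_lapSym_torReflS_dblBox n c m2 S k

/-- `Σ_k lapSym(2n)(k̂)⁻¹ = boxShiftSum (1∕sym) ∅`. [cite: King1986, (4.4) p.670] -/
theorem sum_inv_lapSym_dblBox_eq_boxShiftSum (c m2 : ℝ) :
    ∑ k : KingBox n, (lapSym (dblPer n) c m2 (dblBox n k))⁻¹ = boxShiftSum n (fun p : Fin (d + 1) → ℝ => (m2 + c * ∑ μ, (2 - 2 * Real.cos (p μ)))⁻¹) ∅ := by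
  unfold boxShiftSum
  refine Finset.sum_congr rfl fun k _ => ?_
  rw [← inv_lapSym_torReflS_dblBox n c m2 ∅ k, torReflS_empty]

omit hn in
/-- the inverse symbol is bounded by `m⁻²` (`c ≥ 0`, `m² > 0`). [cite: King1986, (4.4) p.670] -/
theorem abs_inv_sym_le (hc : 0 ≤ c) (hm : 0 < m2) (p : Fin (d + 1) → ℝ) : |(m2 + c * ∑ μ, (2 - 2 * Real.cos (p μ)))⁻¹| ≤ m2⁻¹ := by
  have hS : 0 ≤ c * ∑ μ, (2 - 2 * Real.cos (p μ)) := mul_nonneg hc (Finset.sum_nonneg fun μ _ => by linarith [Real.cos_le_one (p μ)])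
  have hpos : 0 < m2 + c * ∑ μ, (2 - 2 * Real.cos (p μ)) := by linarith
  rw [abs_of_pos (inv_pos.mpr hpos)]
  exact inv_anti₀ hm (by linarith)

/-- ★★★ **THE TORUS COINCIDENT-POINT COVARIANCE vs THE BOX AVERAGE**: for `c ≥ 0`, `m² > 0`, every box `Ω` and every site `x` of the doubled torus,
`|G_{T(2n)}(x,x) − |Ω|⁻¹Σ_{s∈Ω}G^Ω(s,s)| ≤ (2∕m²)·Σ_μ(n_μ)⁻¹` — a surface-to-volume rate. [cite: King1986, (2.17) p.653, (4.4) p.670, §4 p.670 l.8–13] -/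
theorem abs_lapF_dbl_inv_diag_sub_avg_kingBoxGreen_diag_le (hc : 0 ≤ c) (hm : 0 < m2) (x : Tor (dblPer n)) :
    |(lapF (dblPer n) c m2)⁻¹ x x - (Fintype.card (KingBox n) : ℝ)⁻¹ * ∑ s : KingBox n, kingBoxGreen n c m2 s s| ≤ 2 * m2⁻¹ * ∑ μ, ((n μ : ℝ))⁻¹ := by
  set h : (Fin (d + 1) → ℝ) → ℝ := fun p => (m2 + c * ∑ μ, (2 - 2 * Real.cos (p μ)))⁻¹ with hh
  have hBh : ∀ p : Fin (d + 1) → ℝ, (∀ ν, 0 ≤ p ν ∧ p ν ≤ Real.pi) → |h p| ≤ m2⁻¹ := fun p _ => abs_inv_sym_le hc hm p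
  have hP : (0 : ℝ) < ∏ ν, (n ν : ℝ) := Finset.prod_pos fun ν _ => by exact_mod_cast NeZero.pos (n ν)
  have h2 : (0 : ℝ) < 2 ^ (d + 1) := by positivity
  have hT : (lapF (dblPer n) c m2)⁻¹ x x = ((2 : ℝ) ^ (d + 1))⁻¹ * (∏ ν, (n ν : ℝ))⁻¹ * ∑ S : Finset (Fin (d + 1)), boxShiftSum n h S := by
    rw [lapF_inv_diag_eq (dblPer n) hc hm x, sum_inv_lapSym_dblTorus_eq n c m2, card_dblTorus_eq n, card_kingBox n]
    push_cast
    rw [mul_inv]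
  have hΩ : (Fintype.card (KingBox n) : ℝ)⁻¹ * ∑ s : KingBox n, kingBoxGreen n c m2 s s
      = ((2 : ℝ) ^ (d + 1))⁻¹ * (∏ ν, (n ν : ℝ))⁻¹ * ∑ _S : Finset (Fin (d + 1)), boxShiftSum n h ∅ := by
    rw [← trace_boxOp_inv_eq_sum_kingBoxGreen_diag n hc hm, trace_boxOp_inv_eq_sum n hc hm, sum_inv_lapSym_dblBox_eq_boxShiftSum n c m2, card_kingBox n,
      Finset.sum_const, Finset.card_univ, Fintype.card_finset, Fintype.card_fin, nsmul_eq_mul]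
    push_cast
    rw [mul_mul_mul_comm, inv_mul_cancel₀ h2.ne', one_mul]
  rw [hT, hΩ, ← mul_sub, ← Finset.sum_sub_distrib, abs_mul, abs_of_pos (by positivity : (0 : ℝ) < ((2 : ℝ) ^ (d + 1))⁻¹ * (∏ ν, (n ν : ℝ))⁻¹)]
  have hsum : |∑ S : Finset (Fin (d + 1)), (boxShiftSum n h S - boxShiftSum n h ∅)| ≤ ∑ _S : Finset (Fin (d + 1)), 2 * m2⁻¹ * (∏ ν, (n ν : ℝ)) * ∑ μ, ((n μ : ℝ))⁻¹ := by
    refine (Finset.abs_sum_le_sum_abs _ _).trans (Finset.sum_le_sum fun S _ => ?_)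
    refine (abs_boxShiftSum_sub_empty_le n h hBh S).trans ?_
    refine mul_le_mul_of_nonneg_left ?_ (by positivity)
    exact Finset.sum_le_univ_sum_of_nonneg fun μ => by positivity
  rw [Finset.sum_const, Finset.card_univ, Fintype.card_finset, Fintype.card_fin, nsmul_eq_mul] at hsum
  push_cast at hsum
  calc ((2 : ℝ) ^ (d + 1))⁻¹ * (∏ ν, (n ν : ℝ))⁻¹ * |∑ S : Finset (Fin (d + 1)), (boxShiftSum n h S - boxShiftSum n h ∅)|
      ≤ ((2 : ℝ) ^ (d + 1))⁻¹ * (∏ ν, (n ν : ℝ))⁻¹ * (2 ^ (d + 1) * (2 * m2⁻¹ * (∏ ν, (n ν : ℝ)) * ∑ μ, ((n μ : ℝ))⁻¹)) :=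
        mul_le_mul_of_nonneg_left hsum (by positivity)
    _ = 2 * m2⁻¹ * ∑ μ, ((n μ : ℝ))⁻¹ := by field_simp

end Comparison

/-! ## §3 The thermodynamic limit of the averaged diagonal: `K_∞(0)` -/

section Limit

variable {c m2 : ℝ}

/-- the smallest side of a family of boxes tends to `∞` when every side does. [folklore] -/
theorem tendsto_boxMin_atTop (nseq : ℕ → Fin (d + 1) → ℕ) (hlim : ∀ ν, Tendsto (fun j => (nseq j ν : ℝ)) atTop atTop) :
    Tendsto (fun j => Finset.univ.inf' Finset.univ_nonempty (nseq j)) atTop atTop := by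
  rw [tendsto_atTop]
  intro B
  have hall : ∀ᶠ j in atTop, ∀ ν, B ≤ nseq j ν :=
    eventually_all.2 fun ν => (tendsto_natCast_atTop_iff.mp (hlim ν)).eventually_ge_atTop B
  filter_upwards [hall] with j hj
  exact (Finset.le_inf'_iff _ _).2 fun ν _ => hj ν

/-- ★★★ **THE AVERAGED COINCIDENT-POINT COVARIANCE ON `Ω` CONVERGES TO `K_∞(0)`**: along ANY boxes `Ω_j` with all sides `→ ∞` (`c ≥ 0`, `m² > 0`),
`|Ω_j|⁻¹Σ_{s∈Ω_j}G^{Ω_j}(s,s) → K_∞(0)` — the torus value `G_{T(2n_j)}(x,x) → K_∞(0)` (part Ε-f) plus the surface-to-volume rate of §2. [cite: King1986, (2.17) p.653, (4.4) p.670,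
§4 p.670 l.8–13] -/
theorem tendsto_avg_kingBoxGreen_diag (hc : 0 ≤ c) (hm : 0 < m2) (nseq : ℕ → Fin (d + 1) → ℕ) (hpos : ∀ j ν, 0 < nseq j ν)
    (hlim : ∀ ν, Tendsto (fun j => (nseq j ν : ℝ)) atTop atTop) :
    Tendsto (fun j => haveI : ∀ ν, NeZero (nseq j ν) := fun ν => ⟨(hpos j ν).ne'⟩
      (Fintype.card (KingBox (nseq j)) : ℝ)⁻¹ * ∑ s : KingBox (nseq j), kingBoxGreen (nseq j) c m2 s s) atTop (𝓝 (freeKer c m2 (0 : Fin (d + 1) → ℤ))) := by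
  have hκ : 0 < kappaFree c m2 d := kappaFree_pos hc hm d
  -- the torus coincident-point covariance of the doubled tori converges to `K_∞(0)`
  set C : ℝ := 2 / m2 * periodConst (kappaFree c m2 d / 2) d with hC
  have hmin := tendsto_boxMin_atTop nseq hlim
  have hexp : Tendsto (fun j => C * Real.exp (-(kappaFree c m2 d / 4 * (Finset.univ.inf' Finset.univ_nonempty (nseq j) : ℕ)))) atTop (𝓝 0) := by
    have h1 : Tendsto (fun j => -(kappaFree c m2 d / 4 * ((Finset.univ.inf' Finset.univ_nonempty (nseq j) : ℕ) : ℝ))) atTop atBot := by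
      rw [tendsto_neg_atBot_iff]
      exact (tendsto_natCast_atTop_iff.mpr hmin).const_mul_atTop (by positivity)
    simpa using (Real.tendsto_exp_atBot.comp h1).const_mul C
  have hrate : Tendsto (fun j => 2 * m2⁻¹ * ∑ μ, ((nseq j μ : ℝ))⁻¹) atTop (𝓝 0) := by
    have h0 : Tendsto (fun j => ∑ μ, ((nseq j μ : ℝ))⁻¹) atTop (𝓝 0) := by
      have := tendsto_finsetSum (Finset.univ : Finset (Fin (d + 1))) fun μ _ => (hlim μ).inv_tendsto_atTop
      simpa using this
    simpa using h0.const_mul (2 * m2⁻¹)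
  have hsum := hrate.add hexp
  rw [add_zero] at hsum
  refine tendsto_sub_nhds_zero_iff.mp (squeeze_zero_norm (fun j => ?_) hsum)
  haveI : ∀ ν, NeZero (nseq j ν) := fun ν => ⟨(hpos j ν).ne'⟩
  rw [Real.norm_eq_abs]
  -- split through the torus diagonal at the site `0`
  have hL : ∀ i, (Finset.univ.inf' Finset.univ_nonempty (nseq j) : ℕ) ≤ dblPer (nseq j) i := fun i => by
    have : Finset.univ.inf' Finset.univ_nonempty (nseq j) ≤ nseq j i := Finset.inf'_le _ (Finset.mem_univ i)
    simp only [dblPer]; omega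
  have htorus := abs_lapF_inv_sub_freeKer_le (dblPer (nseq j)) hc hm hL (0 : Tor (dblPer (nseq j))) 0
  have hcd : centredDiff (dblPer (nseq j)) (0 : Tor (dblPer (nseq j))) 0 = 0 := by
    have h := centredDiff_dblBox (nseq j) (fun μ => ⟨0, NeZero.pos (nseq j μ)⟩) (fun μ => ⟨0, NeZero.pos (nseq j μ)⟩)
    rw [sub_self] at h
    have h0 : dblBox (nseq j) (fun μ => (⟨0, NeZero.pos (nseq j μ)⟩ : Fin (nseq j μ))) = 0 := by
      funext μ; simp [dblBox]
    rw [h0] at h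
    exact h
  rw [hcd] at htorus
  have hbox := abs_lapF_dbl_inv_diag_sub_avg_kingBoxGreen_diag_le (nseq j) hc hm 0
  calc |(Fintype.card (KingBox (nseq j)) : ℝ)⁻¹ * ∑ s : KingBox (nseq j), kingBoxGreen (nseq j) c m2 s s - freeKer c m2 0|
      ≤ |(Fintype.card (KingBox (nseq j)) : ℝ)⁻¹ * ∑ s : KingBox (nseq j), kingBoxGreen (nseq j) c m2 s s - (lapF (dblPer (nseq j)) c m2)⁻¹ 0 0|
          + |(lapF (dblPer (nseq j)) c m2)⁻¹ 0 0 - freeKer c m2 0| := abs_sub_le _ _ _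
    _ ≤ 2 * m2⁻¹ * ∑ μ, ((nseq j μ : ℝ))⁻¹ + C * Real.exp (-(kappaFree c m2 d / 4 * (Finset.univ.inf' Finset.univ_nonempty (nseq j) : ℕ))) :=
        add_le_add (by rw [abs_sub_comm]; exact hbox) htorus

/-- ★★ **FLUCTUATION–RESPONSE COMMUTES WITH THE FREE-BOUNDARY THERMODYNAMIC LIMIT**: `∂_{m²}(|Ω_j|⁻¹ln det(c(−Δ_free)+m²)_{Ω_j}) → K_∞(0) = ∂_{m²}f_∞` (parts Ε-y ∕ Ϟ-f).
[cite: King1986, (3.89) p.668, (4.4) p.670, §4 p.670] -/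
theorem tendsto_deriv_log_det_boxOp_div_card (hc : 0 ≤ c) (hm : 0 < m2) (nseq : ℕ → Fin (d + 1) → ℕ) (hpos : ∀ j ν, 0 < nseq j ν)
    (hlim : ∀ ν, Tendsto (fun j => (nseq j ν : ℝ)) atTop atTop) :
    Tendsto (fun j => haveI : ∀ ν, NeZero (nseq j ν) := fun ν => ⟨(hpos j ν).ne'⟩
      deriv (fun m => (Fintype.card (KingBox (nseq j)) : ℝ)⁻¹ * Real.log (boxOp (nseq j) c m).det) m2) atTop
      (𝓝 (deriv (fun m : ℝ => kingFreeEnergyInf c m d) m2)) := by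
  rw [(hasDerivAt_kingFreeEnergyInf_eq_freeKer_zero hc hm).deriv]
  refine (tendsto_avg_kingBoxGreen_diag hc hm nseq hpos hlim).congr fun j => ?_
  haveI : ∀ ν, NeZero (nseq j ν) := fun ν => ⟨(hpos j ν).ne'⟩
  rw [(hasDerivAt_log_det_boxOp_div_card (nseq j) hc hm).deriv]

end Limit

end Summit.QuantumFields.YangMills.BalabanUVNodes.N15KingModelRung.TorusSpectral

end
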